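import Mathlib
import HarnessLib
import HarnessLib.Audit
import Summits.AtomisticToContinuum.Statement

/-!
Route: VoronoiNormRung

CLOSED (retired) 2026-08-15T13:47:35Z by operator:999:1257524 — reason: not-a-thesis: assembly does not conclude the sub-problem Statement — note: D-0027 §2.1 audit (human 2026-08-15: routes that do not decide the summit are removed): the assembly concludes `StickyRDCrystallization`, not the sub-problem statement; a NEW conforming route may be opened from the same idea (generated `closes : … → _root_.Crystallization`).. The file is kept as the record of this route; refuted decls are indexed as negative knowledge (`ledger negatives`).

# Route VoronoiNormRung — sticky spheres in the rhombic-dodecahedral (fcc-Voronoi) norm crystallize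
onto fcc in R^3 — a 3-D Heitmann–Radin rung via Hadwiger number 18

RUNG ROUTE WITH AN HONEST CEILING (realises card voronoi-norm-continuation [spine]; absorbs Rung 1 /
R1–R4 of the retired sister card
voronoi-cell-norm-rung-hadwiger-18, whose planner retired it 'mechanism kept in
voronoi-norm-continuation', as both novelty audits
recommended MERGE): it does NOT reach the Euclidean Lennard-Jones conjunct `Crystallization`; its
target X is the three-dimensional
Heitmann–Radin theorem in the norm whose unit ball is the rhombic dodecahedron (twice the Voronoi
cell of fcc),
rd(v) = max_(i<j)(|v_i|+|v_j|)/2. X = StickyRDCrystallization: for the sticky model in this norm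
(configurations of N points pairwise at
rd-distance >= 1, energy = minus the number of pairs at rd-distance exactly 1, ground states =
contact maximisers): (o) ground states exist
for every N; (i) [Blanc–Lewin energetic form] contacts(x^N)/N -> 9 = half the Hadwiger number H(RD)
= 18 = contacts per particle of the fcc
lattice D3 (no periodic rd-packing has more, since every vertex degree is <= 18); (ii) [Blanc–Lewin
positional form, sharpened] for EVERY
sequence of ground states there are translations tau_N such that sum_i f(x_i^N + tau_N) -> sum_(s in
D3) f(s) for every continuous compactly
supported f — full sequence, no rotations, limit = the fcc lattice with multiplicity one. Mechanism:
H(RD) = 18 with a UNIQUE kissing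
configuration N18 = 12 face + 6 vertex contacts = the fcc tiling shell (LarmanZong1999 Thm 2), so a
saturated particle sees x + N18 exactly;
saturation propagates along rd-decreasing N18-paths, the covering radius 1/2 of D3 excludes
intruders, and fcc trial blocks leave only
O(N^(2/3)) unsaturated particles: exact fcc windows around all but O(R^3 N^(2/3)) particles (crux
ExactFccWindows), whence X by the in-tree
exact-matching criterion (CrystallizationLocalLimit). In this norm the two Euclidean d = 3
pathologies are invisible at the first shell:
the wrong (hcp) stacking has an up-vector of rd-length 5/6 < 1 (checked in Sketch.lean) and rotated
grains have no contacts (finite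
isometry group O_h), which is exactly what KissingTwelveDegeneracy / FlexibleKissingArrangements
deny in the Euclidean norm.
Lean: `let rd : EuclideanSpace ℝ (Fin 3) → ℝ := fun v => max (|v 0| + |v 1|) (max (|v 0| + |v 2|)
(|v 1| + |v 2|)) / 2; let IsPacking : (N : ℕ) → (Fin N → EuclideanSpace ℝ (Fin 3)) → Prop := fun N x
=> ∀ i j : Fin N, i ≠ j → 1 ≤ rd (x i - x j); let contacts : (N : ℕ) → (Fin N → EuclideanSpace ℝ
(Fin 3)) → ℕ := fun N x => Nat.card {p : Fin N × Fin N // p.1 < p.2 ∧ rd (x p.1 - x p.2) = 1}; let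
IsGS : (N : ℕ) → (Fin N → EuclideanSpace ℝ (Fin 3)) → Prop := fun N x => IsPacking N x ∧ ∀ y : Fin N
→ EuclideanSpace ℝ (Fin 3), IsPacking N y → contacts N y ≤ contacts N x; let fcc : Set
(EuclideanSpace ℝ (Fin 3)) := {v | ∃ a : Fin 3 → ℤ, Even (∑ i, a i) ∧ ∀ i, v i = a i}; (∀ N : ℕ, ∃ x
: Fin N → EuclideanSpace ℝ (Fin 3), IsGS N x) ∧ (∀ x : (N : ℕ) → (Fin N → EuclideanSpace ℝ (Fin 3)),
(∀ N, IsGS N (x N)) → Tendsto (fun N : ℕ => (contacts N (x N) : ℝ) / N) atTop (𝓝 9)) ∧ (∀ x : (N :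
ℕ) → (Fin N → EuclideanSpace ℝ (Fin 3)), (∀ N, IsGS N (x N)) → ∃ τ : ℕ → EuclideanSpace ℝ (Fin 3), ∀
f : EuclideanSpace ℝ (Fin 3) → ℝ, Continuous f → HasCompactSupport f → Tendsto (fun N : ℕ => ∑ i :
Fin N, f (x N i + τ N)) atTop (𝓝 (∑' s : fcc, f s)))`

## Assembly
Pure logic, checked sorry-free in the planner's Sketch.lean (`assembly_provable := fun h4 h2 hb hg
hc => hc (hg h4 h2 hb) h4 hb`, axioms
propext/Classical.choice/Quot.sound): the two Larman–Zong cruxes and the trial blocks feed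
WindowsFromKissing, whose conclusion is crux 3
ExactFccWindows; CrystallizeFromWindows turns exact windows + the degree bound + trial blocks into
X. The target is a Literature-level
theorem about the rd-sticky model, not the sub-problem constant: the route is a rung (see Kill
criteria / Barriers for what is and is not
claimed about `Crystallization`).

Rationale: WHY THIS LINE. Every proved crystallization theorem descends from the sticky limit, and in d = 2 the
sticky theorem holds for EVERY norm (Brass1996 via
Harborth1974; BeterminFurlanetto2026 = arXiv:2407.20762, Thm 3.2, classification by kissing number
6/8), while in Euclidean d = 3 it is
false as a selection principle (KissingTwelveDegeneracy: every Barlow stacking is kissing-twelve;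
StickySphereClusters). The cards' move is
to deform the METRIC instead of the potential: measured with the crystal's own Voronoi cell, Kepler
is a tiling identity, maximal
coordination is 18 = lattice kissing (LarmanZong1999 Thm 2, read pp. 236–237; Swanepoel2018 §2.1,
§4.1 Prop. 3) and fixes environment AND
stacking at shell one, so the d = 2 mechanism (contact counting + rigidity of the saturated shell)
runs verbatim and answers, for this
norm, the question Swanepoel2018 §4.1 leaves open for d > 2 ("it is not clear if point sets that
maximize m(n, X) have to be pieces of
lattices"). Imported area: combinatorial distance geometry in normed spaces / translative kissing
(Hadwiger) numbers (LarmanZong1999,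
Swanepoel2018, Brass1996); assembly tools are the tree's own
(CrystallizationLocalLimit.tendsto_sum_of_eventually_card_eq). What it does
that prior routes do not: CrystalKissingRigidity / CrystalLocalRigidity /
BenjaminiSchrammGroundStates all fight the Euclidean degeneracies
head-on; this route supplies the programme's first d = 3 Blanc–Lewin (i)+(ii) theorem for a pair
interaction isotropic in its own metric,
a calibration of the 3-D window-to-measure assembly in Lean, and a solvable endpoint t = 0 of the
norm path ||.||_t = (1-t) rd + t |.|
whose t = 1 end is the summit (diagnostic only; no transfer is claimed). Negatives index: empty at
filing.

RANKED CRUXES. #0 StickyRDCrystallization (target) — X as in § Thesis: sticky-RD ground states exist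
for every N, contacts/N -> 9, and translated empirical measures of every ground-state sequence
converge locally to the counting measure of the fcc lattice D3 (integer vectors with even coordinate
sum), full sequence, no rotation. (why it might fail: only through its inputs: a second 18-point
kissing configuration of the rhombic dodecahedron (RDKissingUnique false) would allow non-fcc
saturated bulk; or a typing slip in the inline vocabulary (rd, contacts as Nat.card of ordered
pairs, tsum over the subtype D3).) [LarmanZong1999, Swanepoel2018, HeitmannRadin1980,
BlancLewin2015]
#2 RDKissingUnique (crux) — (card item U18 / sister card R2; LarmanZong1999 Thm 2, uniqueness
clause) if 18 vectors of rd-norm exactly 1 are pairwise at rd-distance >= 1, then each of them is an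
integer vector with sum |a_i| = 2, i.e. the configuration is the fcc shell N18 = 12 x
(+-1,+-1,0)-type + 6 x (+-2,0,0)-type (as a set; no symmetry quotient is needed: N18 is
O_h-invariant and translative problems have no rotations). [difficulty: L] (why it might fail:
Printed proof is 3 lines ('by considering four possibilities') on top of an 18-piece boundary
dissection left as 'it can be verified'; the 14 vertices of RD are themselves pairwise rd >= 1, so
vertex/edge pieces must be cut exactly right; Rem. 2 of the paper is wrong for RD.) [LarmanZong1999,
Swanepoel2018, arXiv:1702.00066]
#3 ExactFccWindows (crux) — (card Rung A / sister card Rung 1; the 3-D Harborth–Heitmann–Radin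
content, unprinted) for every R > 0 there is C such that in every N-particle sticky-RD ground state
all but C N^(2/3) particles i have an EXACT fcc window of Euclidean radius R: for |v| <= R, x_i + v
is occupied iff v in D3. Proof route (= support WindowsFromKissing): degree <= 18 (RDHadwigerBound)
and fcc trial blocks give <= 2C_b N^(2/3) unsaturated particles; a saturated particle sees x + N18
exactly (RDKissingUnique); every s in D3 is reached from 0 by an rd-decreasing N18-path ((a,b,c)
sorted: subtract (1,1,0)-type if b >= 1, else (2,0,0)-type), so saturation of all particles within
rd-radius rho = R/sqrt2 + 1/2 of x_i fills x_i + D3 there; the covering radius 1/2 of D3 in rd (its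
Voronoi cell is {rd <= 1/2}) excludes non-lattice intruders; each unsaturated particle spoils at
most (2 rho + 1)^3 windows. [deps: RDKissingUnique, RDHadwigerBound] [difficulty: M] (why it might
fail: Inherits RDKissingUnique; own risks: the o(N) must be O(N^(2/3)) uniformly in N (trial blocks
for EVERY N, not magic numbers), antiphase walls between fcc cosets must stay (d-1)-dimensional
(they do: walls consist of unsaturated particles), small-N absorbed in C.) [Swanepoel2018,
Harborth1974, HeitmannRadin1980, LarmanZong1999]
#4 RDHadwigerBound (crux) — (sister card R1; LarmanZong1999 Thm 2, first clause: H(rhombic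
dodecahedron) = 18, the bound half) any family of vectors of rd-norm exactly 1, pairwise at
rd-distance >= 1, has at most 18 members. Equivalent to: every vertex of an rd-minimum-distance
graph has degree <= 18 (Swanepoel2018 §4.1). [difficulty: L] (why it might fail: True in print
(LarmanZong1999 via Lemma 1 of Zong: 18 boundary pieces of Minkowski diameter < 1, verification left
to the reader); fails as a Lean item only if the dissection's half-open bookkeeping hides a gap —
then a 19th translate exists and the whole line dies.) [LarmanZong1999, Swanepoel2018]
#9 FccTrialBlocks (support) — fcc trial states for every N: there is C such that for every N some
N-point subset of D3 (an rd-packing automatically: nonzero D3 vectors have rd >= 1) has at least 9N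
- C N^(2/3) contacts (cubes of D3 filled layer by layer; each point has 18 D3-neighbours at
rd-distance 1, boundary loss O(N^(2/3))). [difficulty: M] [Swanepoel2018, ConwaySloane1999]
#9 WindowsFromKissing (support) — glue of the (already materialised) decomposition of
ExactFccWindows: RDHadwigerBound -> RDKissingUnique -> FccTrialBlocks -> ExactFccWindows, by the
counting / propagation / covering-radius argument written under crux 3. [difficulty: M]
[Swanepoel2018, HeitmannRadin1980]
#9 CrystallizeFromWindows (support) — ExactFccWindows -> RDHadwigerBound -> FccTrialBlocks ->
StickyRDCrystallization: (o) contact numbers of N-point rd-packings form a non-empty bounded set of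
naturals (spread points on a line at rd-distance 2), so maximisers exist; (i) 9N - C N^(2/3) <=
contacts(ground state) <= 9N (degree <= 18), divide by N; (ii) pick R(N) -> infinity with C(R(N))
N^(2/3) < N, a particle i_N with an exact R(N)-window, tau_N := -x_(i_N); for f supported in B(0,
R_f) the sums are eventually EQUAL to sum_(s in D3) f(s) (injectivity from rd-separation), cf.
PeriodicConfiguration.tendsto_sum_of_eventually_card_eq in
Literature/MathematicalPhysics/StatisticalMechanics/CrystallizationLocalLimit.lean (D3 as a
PeriodicConfiguration 3 with motif {0}, or directly on the subtype). [difficulty: M]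
[BlancLewin2015, HeitmannRadin1980]

TWO-LAYER PLAN. The decomposition of crux 3 is materialised at layer 1 already (children = cruxes 2,
4 and FccTrialBlocks; glue = WindowsFromKissing), so a
"direct proof" of ExactFccWindows is a proof of the glue. Foreseen glued splits, filed only after a
crux closes: RDKissingUnique <=
RDDissection18 (18 explicit polyhedral pieces of the rd-unit sphere, each of rd-diameter < 1,
covering it: Lemma 1 of LarmanZong1999 made
into a finite linear-arithmetic certificate; shared child of cruxes 2 and 4) -> RDFourCases (one
point per piece forces N18) ->
RDKissingUnique; RDHadwigerBound <= RDDissection18 -> pigeonhole. TENURE EXPANSIONS once X stands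
(new ranked statements, not now):
(B) narrow wells in the rd-metric (Theil-class V o rd): soft kissing stability is AUTOMATIC WITH
LINEAR RATE here — the constraint set
{rd(v_k) in [1,1+eta], rd(v_k - v_l) >= 1 - eta} is a finite union of polytopes depending linearly
on eta, so uniqueness at eta = 0 plus
Hoffman's bound gives C eta-closeness to N18 (contrast FlexibleKissingArrangements in the round
norm) — leaving the framework-rigidity
question of the cards (flat faces: transversally floppy face bonds, kinked vertex bonds) as the one
crux; (C) the soft Hadwiger function
H_rd(eta) and its first jump (rd-analogue of the Tammes-13 radius; kit enumeration); (D) the norm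
path ||.||_t = (1-t) rd + t|.|: certified
thresholds t_ico (first t admitting 13 pairwise-separated unit vectors) and t_stack = 1 (hcp penalty
5/6 + t/6), as Literature facts;
(E) the bcc variant (truncated octahedron, primitive parallelohedron: is H = 14 with uniqueness? kit
first; nothing in print per the audit).

KILL CRITERIA. RDKissingUnique REFUTED (an 18-point rd-kissing configuration other than N18): route
BROKEN; repair only if every 18-configuration is
still a subset of one fcc coset through the centre (then restate ExactFccWindows/X with the
classified family), otherwise close
`refuted:RDKissingUnique` — the rhombic-dodecahedral norm would then be as degenerate as the
Euclidean one and both cards die.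
RDHadwigerBound refuted (19 kissing translates; contradicts LarmanZong1999) closes the route
outright. ExactFccWindows can only fail through
those two or the glue; a refutation with 2 and 4 standing means the propagation/covering argument is
mis-typed -> restate, not close.
Nothing proved elsewhere moots the route (it shares no item with the Euclidean routes); conversely
NOTHING here is claimed to transfer to
`Literature.MathematicalPhysics.StatisticalMechanics.Crystallization`: the t = 1 end of the norm
path is the summit itself and the two
Euclidean obstructions re-enter at t_ico < t_stack = 1. Close `superseded` if a general "unique
Hadwiger configuration => sticky
crystallization in any normed R^d" theorem is filed (this route is its d = 3, K = RD instance).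

NOT DECOMPOSED YET. The 18-piece dissection certificate behind cruxes 2 and 4 (which pieces are
half-open where; whether an LP-duality certificate is shorter);
the D3-as-PeriodicConfiguration bookkeeping and the choice R(N) ~ N^(1/10) inside
CrystallizeFromWindows; the exact constant C_b of the
trial blocks; the "periodic maximum = 9" clause of Blanc–Lewin (i) (trivial from degree <= 18, left
informal because energyPerParticle in
the tree is Euclidean-radial); everything on rungs (B)–(E) of the Two-layer plan; any statement
about Lennard-Jones, in either norm.

CHEAPEST FALSIFIER. A 36-dimensional feasibility search (kit, exact rational LP / branch-and-bound
over face assignments): maximise the number of points on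
the rd-unit sphere (a polyhedral surface with 12 rhombic faces) pairwise at rd-distance >= 1, and
enumerate all 18-point solutions. Expected:
max = 18, unique solution N18 (LarmanZong1999 Thm 2). Any 19-point solution or any second 18-point
solution kills cruxes 4 / 2 and the line.
By hand (done while planning, Sketch.lean + a script): N18 is feasible (min pairwise rd = 1); the 14
vertices of RD are also pairwise
rd >= 1 (a rival saturated-looking local structure of size 14, which is why the bound needs the
boundary dissection and not a volume
count, which only gives 26); single-point slides of a face centre are blocked at first order (rd to
a neighbour drops like 1 - s/2).

NUMBERS. rd(v) = max_(i<j)(|v_i| + |v_j|)/2; |v|/2 <= rd(v) <= |v|/sqrt2. fcc = D3 = integer vectors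
with even sum: rd-shells 18 @ 1 (12 of
Euclidean length sqrt2 + 6 of length 2), 24 @ 3/2, 50 @ 2, 72 @ 5/2 (script). Contacts per particle:
fcc 9, bcc (2Z^3 u 2Z^3+(1,1,1)) 7
(its 8 + 6 Euclidean shells merge at rd = 1), simple cubic 3; hcp is not an rd-contact structure:
reflecting an up-neighbour through the
basal plane gives (-1/3,-1/3,-4/3) of rd-norm 5/6 (Sketch.lean example). H(RD) = H_L(RD) = 18
(LarmanZong1999 Thm 2); H(octahedron) = 18,
H(tetrahedron) = 18 (Talata), H(cube) = 26; m(n, X) = H(X) n/2 - Theta(n^(2/3)) whenever H = H_L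
(Swanepoel2018 §4.1, Prop. 3). Volume
ratio bound (rd <= 3/2)/(rd <= 1/2) = 27 => only H <= 26. Items at open: 8 (target, 3 cruxes, 3
support, assembly).

DEFINITION REQUESTS. None filed at open: the vocabulary (rd, rd-packing, contacts as Nat.card of
ordered contact pairs, sticky-RD ground state, D3, N18) is
typed INLINE with `let`s in every item (elaborated, Sketch.lean rc 0) and can be re-expressed by
set-signature if a grounder prefers named
notions — then: Literature/Geometry/DiscreteGeometry: `rdNorm`, `IsHadwigerFamily K`,
`hadwigerNumber K`; Literature/MathematicalPhysics/
StatisticalMechanics: `contactNumberNorm`, `IsStickyGroundStateNorm`. No cite-fact is requested for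
LarmanZong1999 Thm 2 on purpose: it is
filed as cruxes 2 and 4 to be PROVED (finite certificate), not assumed. Bib keys added this session:
LarmanZong1999, Swanepoel2018,
BeterminFurlanetto2026, Brass1996.

Novelty: Searches (2026-08-15): lit read doi:10.1007/pl00009418 (LarmanZong1999, full text, Thm 2 + proof pp.
236–237, Rem. 2 p. 239); lit read
arXiv:1702.00066 --grep (Swanepoel2018 §2.1 H(RD) = 18 attribution, §4.1 Prop. 3 and the open
question for d > 2); lit read arXiv:2407.20762
--grep (BeterminFurlanetto2026: planar only; Rem. 3.12 / 4.3 open problems all planar); lit search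
--source zbmath "minimum distance graphs
normed spaces maximum number of edges" (3: Swanepoel2018, an Oberwolfach report, SODA 2003);
--source zbmath "Hadwiger number rhombic
dodecahedron ..." (0); --source crossref "crystallization ground state lattice arbitrary norm three
dimensions sticky potential" (15 rows:
only BeterminFurlanetto2026 = doi:10.5802/mrr.25 and Betermin 2019 Morse lattices relevant); lit
galaxy search "rhombic dodecahedron
kissing" --star all (daemon queue timeout, retried: see NOTES); local FTS daemon reset (recorded).
Plus the two refuter novelty audits of
the cards (2026-08-15T10:40Z / 10:42Z: zbMATH 'Hadwiger number truncated octahedron' / 'translative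
kissing number parallelohedron' /
'crystallization normed' all 0; crossref 'kissing numbers convex bodies' 12 rows, pure
kissing-number papers).
Nearest prior art found: BeterminFurlanetto2026 (arXiv:2407.20762) Thm 3.2 — sticky crystallization
for every PLANAR norm via Brass1996's
exact finite-n maximisers; LarmanZong1999 Thm 2 — H(RD) = 18 with unique configuration (the d = 3
rigidity input, published, no energy
or ground-state conten  [refs: 10.1007/pl00009418, 10.5802/mrr.25, 1702.00066, 2407.20762, doi:10.1007/pl00009418, doi:10.5802/mrr.25, LarmanZong1999, Swanepoel2018, BeterminFurlanetto2026, Brass1996, HeitmannRadin1980, Harborth1974]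

Barriers (technique_class: norm-rung translative-kissing contact-graph): - technique_class: norm-rung translative-kissing contact-graph
- Literature.Barriers.AtomisticToContinuum.KissingTwelveDegeneracy: its technique class
(contact-graph / kissing-number transplant to d = 3) is exactly ours, but it blocks the transplant
AS A ROUTE TO `IsCrystallizing lennardJones 3`; nothing here targets the Euclidean statement. In the
rd-norm the barrier's witness family disappears: maximal coordination is 18, not 12, the six vertex
contacts pin the second Euclidean shell, and every non-fcc Barlow environment loses contacts at
shell one (hcp up-vector rd = 5/6). The barrier is recovered, not evaded, at the t = 1 end of the
norm path — declared.
- Literature.Barriers.AtomisticToContinuum.FlexibleKissingArrangements: single-shell inference is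
what the barrier forbids for round balls (21-dimensional icosahedral flex); in a translative problem
there is no rotational freedom and, given RDKissingUnique, the saturated shell is the fixed vector
set N18 — single-site inference is valid here and is crux 2's content; the Narrow form (count-only
inputs) is likewise inapplicable because rd-kissing with 18 = H forces the configuration.
- Literature.Barriers.AtomisticToContinuum.StickySphereClusters: Euclidean finite-N degeneracy of
contact maximisers (octahedron vs capped bipyramid at 12 contacts); the route's statements are
bulk/asymptotic (O(N^(2/3)) defects allowed, no finite-N exactness claimed), and in the rd-norm the
octahedron's three diagonals are contacts (rd(2,0,0)

History (route lifecycle, newest last):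
- 2026-08-15T13:47:35Z · CLOSED retired — not-a-thesis: assembly does not conclude the sub-problem Statement (operator:999:1257524)

sub-problem: Crystallization · status: closed(retired) · opened planner-plancard-AtomisticToContinuum-Crystal-bc72130c-0 2026-08-15T11:27:39Z · rev 0 · ledger route-AtomisticToContinuum-VoronoiNormRung
GENERATED by the gate from the ledger (D-0016/17). Provers cite these decls: `theorem foo : Summit.AtomisticToContinuum.Crystallization.Theses.VoronoiNormRung.<Decl> := …` in Summits/AtomisticToContinuum/Crystallization/Theorems/<Name>.lean.
-/

namespace Summit.AtomisticToContinuum.Crystallization.Theses.VoronoiNormRung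

open scoped BigOperators Topology Manifold Classical MeasureTheory ProbabilityTheory Matrix InnerProductSpace ComplexConjugate ContinuousMap
open Filter Set Function TopologicalSpace MeasureTheory

attribute [summit_statement] _root_.Crystallization

/-- item stmt-AtomisticToContinuum-4094 · target · rank 0 · closed · moot by None · by planner
why it might fail: only through its inputs: a second 18-point kissing configuration of the rhombic dodecahedron (RDKissingUnique false) would allow non-fcc saturated bulk; or a typing slip in the inline vocabulary (rd, contacts as Nat.card of ordered pairs, tsum over the subtype D3).
sources: LarmanZong1999, Swanepoel2018, HeitmannRadin1980, BlancLewin2015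
[target] X as in § Thesis: sticky-RD ground states exist for every N, contacts/N -> 9, and
translated empirical measures of every ground-state sequence converge locally to the counting
measure of the fcc lattice D3 (integer vectors with even coordinate sum), full sequence, no
rotation. -/
@[route_item "route-AtomisticToContinuum-VoronoiNormRung"]
def StickyRDCrystallization : Prop :=
  let rd : EuclideanSpace ℝ (Fin 3) → ℝ := fun v => max (|v 0| + |v 1|) (max (|v 0| + |v 2|) (|v 1| + |v 2|)) / 2; let IsPacking : (N : ℕ) → (Fin N → EuclideanSpace ℝ (Fin 3)) → Prop := fun N x => ∀ i j : Fin N, i ≠ j → 1 ≤ rd (x i - x j); let contacts : (N : ℕ) → (Fin N → EuclideanSpace ℝ (Fin 3)) → ℕ := fun N x => Nat.card {p : Fin N × Fin N // p.1 < p.2 ∧ rd (x p.1 - x p.2) = 1}; let IsGS : (N : ℕ) → (Fin N → EuclideanSpace ℝ (Fin 3)) → Prop := fun N x => IsPacking N x ∧ ∀ y : Fin N → EuclideanSpace ℝ (Fin 3), IsPacking N y → contacts N y ≤ contacts N x; let fcc : Set (EuclideanSpace ℝ (Fin 3)) := {v | ∃ a : Fin 3 → ℤ, Even (∑ i, a i)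 ∧ ∀ i, v i = a i}; (∀ N : ℕ, ∃ x : Fin N → EuclideanSpace ℝ (Fin 3), IsGS N x) ∧ (∀ x : (N : ℕ) → (Fin N → EuclideanSpace ℝ (Fin 3)), (∀ N, IsGS N (x N)) → Tendsto (fun N : ℕ => (contacts N (x N) : ℝ) / N) atTop (𝓝 9)) ∧ (∀ x : (N : ℕ) → (Fin N → EuclideanSpace ℝ (Fin 3)), (∀ N, IsGS N (x N)) → ∃ τ : ℕ → EuclideanSpace ℝ (Fin 3), ∀ f : EuclideanSpace ℝ (Fin 3) → ℝ, Continuous f → HasCompactSupport f → Tendsto (fun N : ℕ => ∑ i : Fin N, f (x N i + τ N)) atTop (𝓝 (∑' s : fcc, f s)))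

/-- item stmt-AtomisticToContinuum-4095 · crux · rank 2 · closed · moot by None · by planner
why it might fail: Printed proof is 3 lines ('by considering four possibilities') on top of an 18-piece boundary dissection left as 'it can be verified'; the 14 vertices of RD are themselves pairwise rd >= 1, so vertex/edge pieces must be cut exactly right; Rem. 2 of the paper is wrong for RD.
sources: LarmanZong1999, Swanepoel2018, arXiv:1702.00066
[crux] (card item U18 / sister card R2; LarmanZong1999 Thm 2, uniqueness clause) if 18 vectors of
rd-norm exactly 1 are pairwise at rd-distance >= 1, then each of them is an integer vector with sum
|a_i| = 2, i.e. the configuration is the fcc shell N18 = 12 x (+-1,+-1,0)-type + 6 x (+-2,0,0)-type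
(as a set; no symmetry quotient is needed: N18 is O_h-invariant and translative problems have no
rotations). [difficulty: L] -/
@[route_item "route-AtomisticToContinuum-VoronoiNormRung"]
def RDKissingUnique : Prop :=
  let rd : EuclideanSpace ℝ (Fin 3) → ℝ := fun v => max (|v 0| + |v 1|) (max (|v 0| + |v 2|) (|v 1| + |v 2|)) / 2; ∀ v : Fin 18 → EuclideanSpace ℝ (Fin 3), (∀ k, rd (v k) = 1) → (∀ k l, k ≠ l → 1 ≤ rd (v k - v l)) → ∀ k, ∃ a : Fin 3 → ℤ, (∑ i, |a i|) = 2 ∧ ∀ i, v k i = a i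

/-- item stmt-AtomisticToContinuum-4096 · crux · rank 3 · closed · moot by None · by planner
why it might fail: Inherits RDKissingUnique; own risks: the o(N) must be O(N^(2/3)) uniformly in N (trial blocks for EVERY N, not magic numbers), antiphase walls between fcc cosets must stay (d-1)-dimensional (they do: walls consist of unsaturated particles), small-N absorbed in C.
sources: Swanepoel2018, Harborth1974, HeitmannRadin1980, LarmanZong1999
[crux] (card Rung A / sister card Rung 1; the 3-D Harborth–Heitmann–Radin content, unprinted) for
every R > 0 there is C such that in every N-particle sticky-RD ground state all but C N^(2/3)
particles i have an EXACT fcc window of Euclidean radius R: for |v| <= R, x_i + v is occupied iff v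
in D3. Proof route (= support WindowsFromKissing): degree <= 18 (RDHadwigerBound) and fcc trial
blocks give <= 2C_b N^(2/3) unsaturated particles; a saturated particle sees x + N18 exactly
(RDKissingUnique); every s in D3 is reached from 0 by an rd-decreasing N18-path ((a,b,c) sorted:
subtract (1,1,0)-type if b >= 1, else (2,0,0)-type), so saturation of all particles within rd-radius
rho = R/sqrt2 + 1/2 of x_i fills x_i + D3 there; the covering radius 1/2 of D3 in rd (its Voronoi
cell is {rd <= 1/2}) excludes non-lattice intruders; each unsaturated particle spoils at most (2 rho
+ 1)^3 windows. [deps: RDKissingUnique, RDHadwigerBound] [difficulty: M] -/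
@[route_item "route-AtomisticToContinuum-VoronoiNormRung"]
def ExactFccWindows : Prop :=
  let rd : EuclideanSpace ℝ (Fin 3) → ℝ := fun v => max (|v 0| + |v 1|) (max (|v 0| + |v 2|) (|v 1| + |v 2|)) / 2; let IsPacking : (N : ℕ) → (Fin N → EuclideanSpace ℝ (Fin 3)) → Prop := fun N x => ∀ i j : Fin N, i ≠ j → 1 ≤ rd (x i - x j); let contacts : (N : ℕ) → (Fin N → EuclideanSpace ℝ (Fin 3)) → ℕ := fun N x => Nat.card {p : Fin N × Fin N // p.1 < p.2 ∧ rd (x p.1 - x p.2) = 1}; let IsGS : (N : ℕ) → (Fin N → EuclideanSpace ℝ (Fin 3)) → Prop := fun N x => IsPacking N x ∧ ∀ y : Fin N → EuclideanSpace ℝ (Fin 3), IsPacking N y → contacts N y ≤ contacts N x; let fcc : Set (EuclideanSpace ℝ (Fin 3)) := {v | ∃ a : Fin 3 → ℤ, Even (∑ i, a i) ∧ ∀ i, v i = a i}; ∀ R : ℝ, 0 < R → ∃ C : ℝ, ∀ (N : ℕ) (x : Fin N → EuclideanSpace ℝ (Fin 3)), IsGS N x → (Nat.card {i : Fin N // ¬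 ∀ v : EuclideanSpace ℝ (Fin 3), ‖v‖ ≤ R → ((∃ j, x j = x i + v) ↔ v ∈ fcc)} : ℝ) ≤ C * (N : ℝ) ^ (2 / 3 : ℝ)

/-- item stmt-AtomisticToContinuum-4097 · crux · rank 4 · closed · moot by None · by planner
why it might fail: True in print (LarmanZong1999 via Lemma 1 of Zong: 18 boundary pieces of Minkowski diameter < 1, verification left to the reader); fails as a Lean item only if the dissection's half-open bookkeeping hides a gap — then a 19th translate exists and the whole line dies.
sources: LarmanZong1999, Swanepoel2018
[crux] (sister card R1; LarmanZong1999 Thm 2, first clause: H(rhombic dodecahedron) = 18, the bound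
half) any family of vectors of rd-norm exactly 1, pairwise at rd-distance >= 1, has at most 18
members. Equivalent to: every vertex of an rd-minimum-distance graph has degree <= 18 (Swanepoel2018
§4.1). [difficulty: L] -/
@[route_item "route-AtomisticToContinuum-VoronoiNormRung"]
def RDHadwigerBound : Prop :=
  let rd : EuclideanSpace ℝ (Fin 3) → ℝ := fun v => max (|v 0| + |v 1|) (max (|v 0| + |v 2|) (|v 1| + |v 2|)) / 2; ∀ (m : ℕ) (v : Fin m → EuclideanSpace ℝ (Fin 3)), (∀ k, rd (v k) = 1) → (∀ k l, k ≠ l → 1 ≤ rd (v k - v l)) → m ≤ 18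

/-- item stmt-AtomisticToContinuum-4098 · support · rank 9 · closed · moot by None · by planner
sources: Swanepoel2018, ConwaySloane1999
[support] fcc trial states for every N: there is C such that for every N some N-point subset of D3
(an rd-packing automatically: nonzero D3 vectors have rd >= 1) has at least 9N - C N^(2/3) contacts
(cubes of D3 filled layer by layer; each point has 18 D3-neighbours at rd-distance 1, boundary loss
O(N^(2/3))). [difficulty: M] -/
@[route_item "route-AtomisticToContinuum-VoronoiNormRung"]
def FccTrialBlocks : Prop :=
  let rd : EuclideanSpace ℝ (Fin 3) → ℝ := fun v => max (|v 0| + |v 1|) (max (|v 0| + |v 2|) (|v 1| + |v 2|)) / 2; let IsPacking : (N : ℕ) → (Fin N → EuclideanSpace ℝ (Fin 3)) → Prop := fun N x => ∀ i j : Fin N, i ≠ j → 1 ≤ rd (x i - x j); let contacts : (N : ℕ) → (Fin N → EuclideanSpace ℝ (Fin 3)) → ℕ := fun N x => Nat.card {p : Fin N × Fin N // p.1 < p.2 ∧ rd (x p.1 - x p.2) = 1}; ∃ C : ℝ, ∀ N : ℕ, ∃ x : Fin N → EuclideanSpace ℝ (Fin 3), IsPacking N x ∧ (∀ i, ∃ a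 : Fin 3 → ℤ, Even (∑ k, a k) ∧ ∀ k, x i k = a k) ∧ 9 * (N : ℝ) - C * (N : ℝ) ^ (2 / 3 : ℝ) ≤ (contacts N x : ℝ)

/-- item stmt-AtomisticToContinuum-4099 · support · rank 9 · closed · moot by None · by planner
sources: Swanepoel2018, HeitmannRadin1980
[support] glue of the (already materialised) decomposition of ExactFccWindows: RDHadwigerBound ->
RDKissingUnique -> FccTrialBlocks -> ExactFccWindows, by the counting / propagation /
covering-radius argument written under crux 3. [difficulty: M] -/
@[route_item "route-AtomisticToContinuum-VoronoiNormRung"]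
def WindowsFromKissing : Prop :=
  RDHadwigerBound → RDKissingUnique → FccTrialBlocks → ExactFccWindows

/-- item stmt-AtomisticToContinuum-4100 · support · rank 9 · closed · moot by None · by planner
sources: BlancLewin2015, HeitmannRadin1980
[support] ExactFccWindows -> RDHadwigerBound -> FccTrialBlocks -> StickyRDCrystallization: (o)
contact numbers of N-point rd-packings form a non-empty bounded set of naturals (spread points on a
line at rd-distance 2), so maximisers exist; (i) 9N - C N^(2/3) <= contacts(ground state) <= 9N
(degree <= 18), divide by N; (ii) pick R(N) -> infinity with C(R(N)) N^(2/3) < N, a particle i_N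
with an exact R(N)-window, tau_N := -x_(i_N); for f supported in B(0, R_f) the sums are eventually
EQUAL to sum_(s in D3) f(s) (injectivity from rd-separation), cf.
PeriodicConfiguration.tendsto_sum_of_eventually_card_eq in
Literature/MathematicalPhysics/StatisticalMechanics/CrystallizationLocalLimit.lean (D3 as a
PeriodicConfiguration 3 with motif {0}, or directly on the subtype). [difficulty: M] -/
@[route_item "route-AtomisticToContinuum-VoronoiNormRung"]
def CrystallizeFromWindows : Prop :=
  ExactFccWindows → RDHadwigerBound → FccTrialBlocks → StickyRDCrystallization

/-- item stmt-AtomisticToContinuum-4101 · assembly · rank 1 · closed · moot by None · by planner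
sources: LarmanZong1999, HeitmannRadin1980, BlancLewin2015
[assembly] RDHadwigerBound -> RDKissingUnique -> FccTrialBlocks -> WindowsFromKissing ->
CrystallizeFromWindows -> StickyRDCrystallization. -/
@[route_item "route-AtomisticToContinuum-VoronoiNormRung"]
def Assembly : Prop :=
  RDHadwigerBound → RDKissingUnique → FccTrialBlocks → WindowsFromKissing → CrystallizeFromWindows → StickyRDCrystallization

end Summit.AtomisticToContinuum.Crystallization.Theses.VoronoiNormRung
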